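import Literature.Geometry.Lorentzian.CoordCurvature
import HarnessLib

/-!
# The second Bianchi identity and `dS = 2 div Ric` for metric components

Continuation of `CoordCurvature.lean` (pure Fréchet calculus on a finite-dimensional real normed
space `E`; `G : E → (E →L E →L ℝ)` the components of a pseudo-Riemannian metric, smooth,
symmetric and nondegenerate on an open set `V`, `IsMetricOn G V`). With the Christoffel map
`Γ = chrAt G`, the curvature endomorphism `R = riemAt G`, the Ricci form `Ric = ricAt G` and the
scalar curvature `S = scalAt G` of that file we define the covariant derivatives along a
constant field `W`

* `cov₂At G β x W (Y, Z) = ∂_W β(Y,Z) − β(Γ(W,Y), Z) − β(Y, Γ(W,Z))` of a field of bilinear forms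
  `β` (O'Neill 1983, Ch. 2, Prop. 2.13 / Ch. 3, p. 86: `(∇_W β)(Y,Z)`),
* `covRiemAt G x W X Y = ∂_W R(X,Y) + [Γ_W, R(X,Y)] − R(Γ(W,X), Y) − R(X, Γ(W,Y))` of the
  curvature endomorphism (O'Neill 1983, Ch. 3, p. 76: `(D_W R)(X,Y)`),

and prove:

* `IsMetricOn.fderiv_sharpAt` — `∂_W ♯ = −♯ ∘ ∂_W G ∘ ♯`;
* `IsMetricOn.fderiv_mtrAt` — **metric traces commute with covariant differentiation**:
  `∂_Y (tr_G β) = tr_G (∇_Y β)` (metric compatibility; O'Neill 1983, Ch. 3, p. 86);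
* `IsMetricOn.sum_coord_covRiemAt` — `tr (X ↦ (∇_W R)(X,Y)Z) = (∇_W Ric)(Y,Z)` (contraction
  commutes with `∇`);
* `IsMetricOn.apply_covRiemAt` and the symmetries of `G((∇_W R)(X,Y)Z, V)` inherited from those
  of the curvature tensor;
* **`IsMetricOn.covRiemAt_cyclic` — the second Bianchi identity**
  `(∇_W R)(X,Y) + (∇_X R)(Y,W) + (∇_Y R)(W,X) = 0` (O'Neill 1983, Ch. 3, Prop. 3.37; here by the
  direct computation in coordinates: symmetry of `D²Γ`, torsion-freeness and the Jacobi identity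
  in `End E`);
* **`IsMetricOn.fderiv_scalAt` — the contracted Bianchi identity `dS = 2 div Ric`**
  (O'Neill 1983, Ch. 3, Cor. 3.54; Topping 2006, (2.1.9)): in any basis `b` with inverse metric
  coefficients `g^{kl} = ginv G b x k l`,
  `∂_Y S = 2 Σ_{kl} g^{kl} (∇_{b_k} Ric)(Y, b_l)`.

Everything is proved; no definition of `Prop` type. This is the second layer of the coordinate
proof of the evolution of the scalar curvature under the Ricci flow (Topping 2006, Prop. 2.5.4)
for `Literature.Geometry.Riemannian.ricciFlow_scalarCurvature_lowerBound`.

## References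

* B. O'Neill, *Semi-Riemannian geometry with applications to relativity*, Academic Press 1983,
  Ch. 3: Prop. 3.37 (second Bianchi identity), Cor. 3.54 (`dS = 2 div Ric`), p. 86 (divergence,
  contraction commutes with `∇`), Prop. 3.36 (symmetries of curvature). [ONeill1983]
* P. Topping, *Lectures on the Ricci flow*, LMS Lecture Note Series 325, CUP 2006, §2.1, (2.1.9)
  (contracted second Bianchi identity `δ Ric + ½ dR = 0`). [Topping2006]
-/

noncomputable section

set_option maxSynthPendingDepth 3

open Set Filter ContinuousLinearMap Module
open scoped Topology ContDiff

namespace Literature.Geometry.Lorentzian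

namespace MetricCoord

variable {E : Type*} [NormedAddCommGroup E] [NormedSpace ℝ E]

/-! ### Covariant derivative of a field of bilinear forms along a constant field -/

section CovBilin

variable (G : E → E →L[ℝ] E →L[ℝ] ℝ) (β : E → E →L[ℝ] E →L[ℝ] ℝ)

/-- The flip of a bilinear form as a continuous linear operator. [folklore] -/
def flipCLM : (E →L[ℝ] E →L[ℝ] ℝ) →L[ℝ] (E →L[ℝ] E →L[ℝ] ℝ) :=
  ((ContinuousLinearMap.flipₗᵢ ℝ E E ℝ).toContinuousLinearEquiv : _ →L[ℝ] _)

/-- Unfolding lemma for `flipCLM`. [folklore] -/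
@[simp]
theorem flipCLM_apply (T : E →L[ℝ] E →L[ℝ] ℝ) : flipCLM T = T.flip := rfl

/-- The **covariant derivative of a field of bilinear forms along a constant field**, as a
trilinear map: `(∇β)_x(W; Y, Z) = ∂_W β(Y, Z) − β(Γ(W,Y), Z) − β(Y, Γ(W,Z))`
(O'Neill 1983, Ch. 2, Prop. 2.13 (the covariant differential of a `(0,2)` tensor) with the
Christoffel map of Ch. 3, Prop. 3.13 on constant fields). [cite: ONeill1983, Ch. 2, Prop. 2.13] -/
def cov₂At (x : E) : E →L[ℝ] E →L[ℝ] E →L[ℝ] ℝ :=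
  fderiv ℝ β x - (ContinuousLinearMap.compL ℝ E E (E →L[ℝ] ℝ) (β x)).comp (chrAt G x)
    - flipCLM.comp ((ContinuousLinearMap.compL ℝ E E (E →L[ℝ] ℝ) (β x).flip).comp (chrAt G x))

/-- Unfolding lemma: `(∇β)(W; Y, Z) = ∂_W β(Y,Z) − β(Γ(W,Y), Z) − β(Y, Γ(W,Z))`.
[cite: ONeill1983, Ch. 2, Prop. 2.13] -/
@[simp]
theorem cov₂At_apply (x W Y Z : E) :
    cov₂At G β x W Y Z = fderiv ℝ β x W Y Z - β x (chrAt G x W Y) Z - β x Y (chrAt G x W Z) := by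
  simp [cov₂At]

/-- `(∇β)(W)` as a bilinear form: `∂_W β − β ∘ Γ_W − (βᵗ ∘ Γ_W)ᵗ`. [folklore] -/
theorem cov₂At_apply₁ (x W : E) :
    cov₂At G β x W = fderiv ℝ β x W - (β x).comp (chrAt G x W)
      - ((β x).flip.comp (chrAt G x W)).flip := by
  ext Y Z
  simp [cov₂At]

end CovBilin

/-! ### Derivative of `♯` and of metric traces -/

section SharpDeriv

variable [CompleteSpace E] {G : E → E →L[ℝ] E →L[ℝ] ℝ} {V : Set E} {x : E}

/-- **Derivative of the inverse metric**: `∂_W ♯ = −♯ ∘ ∂_W G ∘ ♯` (differentiate `G ∘ ♯ = id`).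
[folklore] -/
theorem IsMetricOn.fderiv_sharpAt (hG : IsMetricOn G V) (hx : x ∈ V) (W : E) :
    fderiv ℝ (sharpAt G) x W = -(sharpAt G x).comp ((fderiv ℝ G x W).comp (sharpAt G x)) := by
  have hi := hG.isInvertible x hx
  -- `y ↦ G y ∘ ♯_y` is constant (`= id`) near `x`
  have hconst : (fun y ↦ (G y).comp (sharpAt G y)) =ᶠ[𝓝 x]
      fun _ ↦ ContinuousLinearMap.id ℝ (E →L[ℝ] ℝ) :=
    (hG.eventually_mem hx).mono fun y hy ↦ (hG.isInvertible y hy).self_comp_inverse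
  have h0 : fderiv ℝ (fun y ↦ (G y).comp (sharpAt G y)) x = 0 := by
    rw [hconst.fderiv_eq, fderiv_fun_const]; rfl
  have hprod := fderiv_clm_comp (hG.differentiableAt hx) (hG.differentiableAt_sharpAt hx)
  have hW := congrArg (fun T ↦ T W) hprod
  simp only [h0, _root_.zero_apply, _root_.add_apply, ContinuousLinearMap.comp_apply,
    ContinuousLinearMap.flip_apply, ContinuousLinearMap.compL_apply] at hW
  -- `0 = G x ∘ D♯(W) + DG(W) ∘ ♯`; compose with `♯` on the left
  have h1 : (G x).comp (fderiv ℝ (sharpAt G) x W) = -(fderiv ℝ G x W).comp (sharpAt G x) :=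
    eq_neg_of_add_eq_zero_left hW.symm
  have h2 : (sharpAt G x).comp ((G x).comp (fderiv ℝ (sharpAt G) x W)) =
      (sharpAt G x).comp (-(fderiv ℝ G x W).comp (sharpAt G x)) := by rw [h1]
  rw [← ContinuousLinearMap.comp_assoc, show (sharpAt G x).comp (G x) = ContinuousLinearMap.id ℝ E
    from hi.inverse_comp_self, ContinuousLinearMap.id_comp, ContinuousLinearMap.comp_neg] at h2
  exact h2

omit [CompleteSpace E] in
/-- Metric compatibility as an identity of bilinear forms: `∂_W G = G ∘ Γ_W + ((Gᵗ) ∘ Γ_W)ᵗ`.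
[cite: ONeill1983, Ch. 3, Prop. 3.13] -/
theorem IsMetricOn.fderiv_eq_comp_chrAt (hG : IsMetricOn G V) (hx : x ∈ V) (W : E) :
    fderiv ℝ G x W = (G x).comp (chrAt G x W) + ((G x).flip.comp (chrAt G x W)).flip := by
  ext v w
  simp only [_root_.add_apply, ContinuousLinearMap.comp_apply, ContinuousLinearMap.flip_apply]
  exact hG.fderiv_eq_chrAt hx W v w

variable [FiniteDimensional ℝ E]

omit [CompleteSpace E] in
/-- `tr (A ∘ B) = tr (B ∘ A)` for continuous endomorphisms. [folklore] -/
theorem traceCLM_comp_comm (A B : E →L[ℝ] E) : traceCLM E (A.comp B) = traceCLM E (B.comp A) := by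
  simp only [traceCLM_apply]
  exact LinearMap.trace_comp_comm' _ _

/-- **Metric traces commute with covariant differentiation**: for a field of bilinear forms `β`
differentiable at `x`, `∂_Y (tr_G β)(x) = tr_G ((∇β)_x(Y; ·, ·))`, i.e. `∇_Y (g^{ij} β_{ij}) =
g^{ij} β_{ij;Y}` (`∇g = 0`; O'Neill 1983, Ch. 3, p. 86: contraction commutes with covariant
derivatives for the Levi-Civita connection). [cite: ONeill1983, Ch. 3, p. 86] -/
theorem IsMetricOn.fderiv_mtrAt (hG : IsMetricOn G V) (hx : x ∈ V) {β : E → E →L[ℝ] E →L[ℝ] ℝ}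
    (hβ : DifferentiableAt ℝ β x) (Y : E) :
    fderiv ℝ (fun y ↦ mtrAt G y (β y)) x Y = mtrAt G x (cov₂At G β x Y) := by
  have hi := hG.isInvertible x hx
  -- derivative of `y ↦ tr (♯_y ∘ β_y)`
  have hcomp := (hG.differentiableAt_sharpAt hx).hasFDerivAt.clm_comp hβ.hasFDerivAt
  have htr : HasFDerivAt (fun y ↦ mtrAt G y (β y))
      ((traceCLM E).comp
        ((ContinuousLinearMap.compL ℝ E (E →L[ℝ] ℝ) E (sharpAt G x)).comp (fderiv ℝ β x) +
          ((ContinuousLinearMap.compL ℝ E (E →L[ℝ] ℝ) E).flip (β x)).comp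
            (fderiv ℝ (sharpAt G) x))) x := by
    have := (traceCLM E).hasFDerivAt.comp x hcomp
    simpa [mtrAt_eq_traceCLM, Function.comp_def] using this
  rw [htr.fderiv]
  simp only [ContinuousLinearMap.comp_apply, _root_.add_apply,
    ContinuousLinearMap.compL_apply, ContinuousLinearMap.flip_apply, mtrAt_eq_traceCLM,
    cov₂At_apply₁]
  -- the correction terms: `D♯(Y) ∘ β = −Γ_Y ∘ ♯ ∘ β − ♯ ∘ (βᵗ ∘ Γ_Y)ᵗ`
  have key : (fderiv ℝ (sharpAt G) x Y).comp (β x) =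
      -((chrAt G x Y).comp ((sharpAt G x).comp (β x)))
        - (sharpAt G x).comp (((β x).flip.comp (chrAt G x Y)).flip) := by
    rw [hG.fderiv_sharpAt hx Y, hG.fderiv_eq_comp_chrAt hx Y]
    ext v
    have h1 : ((G x).flip.comp (chrAt G x Y)).flip (sharpAt G x (β x v)) =
        ((β x).flip.comp (chrAt G x Y)).flip v := by
      ext c
      simp only [ContinuousLinearMap.flip_apply, ContinuousLinearMap.comp_apply]
      exact apply_sharpAt_apply hi _ _
    simp only [ContinuousLinearMap.neg_comp, _root_.neg_apply, _root_.sub_apply,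
      ContinuousLinearMap.comp_apply, _root_.add_apply, map_add, neg_add, h1, sharpAt_apply hi]
    abel
  rw [key]
  simp only [map_add, map_sub, map_neg, ContinuousLinearMap.comp_sub]
  rw [traceCLM_comp_comm (chrAt G x Y) ((sharpAt G x).comp (β x)), ContinuousLinearMap.comp_assoc]
  abel

/-- **`dS(Y) = tr_G (∇_Y Ric)`**: the differential of the scalar curvature is the metric trace of
the covariant derivative of the Ricci form. [cite: ONeill1983, Ch. 3, p. 86] -/
theorem IsMetricOn.fderiv_scalAt_eq_mtrAt (hG : IsMetricOn G V) (hx : x ∈ V) (Y : E) :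
    fderiv ℝ (scalAt G) x Y = mtrAt G x (cov₂At G (ricAt G) x Y) :=
  hG.fderiv_mtrAt hx (hG.differentiableAt_ricAt hx) Y

end SharpDeriv

/-! ### Covariant derivative of the curvature endomorphism -/

section CovRiem

variable (G : E → E →L[ℝ] E →L[ℝ] ℝ)

/-- The **covariant derivative of the curvature endomorphism along a constant field**:
`(∇_W R)_x(X, Y) = ∂_W R(X,Y) + Γ_W ∘ R(X,Y) − R(X,Y) ∘ Γ_W − R(Γ(W,X), Y) − R(X, Γ(W,Y)) ∈ End E`
(O'Neill 1983, Ch. 3, p. 76: `(D_W R)(X,Y)V = D_W(R(X,Y)V) − R(D_W X,Y)V − R(X,D_W Y)V − R(X,Y)D_W V`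
on constant fields). [cite: ONeill1983, Ch. 3, Prop. 3.37] -/
def covRiemAt (x W X Y : E) : E →L[ℝ] E :=
  fderiv ℝ (fun y ↦ riemAt G y X Y) x W + (chrAt G x W).comp (riemAt G x X Y)
    - (riemAt G x X Y).comp (chrAt G x W) - riemAt G x (chrAt G x W X) Y
    - riemAt G x X (chrAt G x W Y)

/-- Unfolding lemma for `covRiemAt`. [cite: ONeill1983, Ch. 3, Prop. 3.37] -/
theorem covRiemAt_apply (x W X Y Z : E) :
    covRiemAt G x W X Y Z = fderiv ℝ (fun y ↦ riemAt G y X Y) x W Z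
      + chrAt G x W (riemAt G x X Y Z) - riemAt G x X Y (chrAt G x W Z)
      - riemAt G x (chrAt G x W X) Y Z - riemAt G x X (chrAt G x W Y) Z := rfl

variable {G} {V : Set E} {x : E} [CompleteSpace E]

omit [CompleteSpace E] in
/-- `(∇_W R)(Y, X) = −(∇_W R)(X, Y)`. [cite: ONeill1983, Ch. 3, Prop. 3.36 (1)] -/
theorem covRiemAt_swap (x W X Y : E) : covRiemAt G x W Y X = -covRiemAt G x W X Y := by
  have h : (fun y ↦ riemAt G y Y X) = fun y ↦ -riemAt G y X Y := funext fun y ↦ riemAt_swap G y X Y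
  simp only [covRiemAt, h, fderiv_fun_neg]
  rw [riemAt_swap G x X Y, riemAt_swap G x X (chrAt G x W Y), riemAt_swap G x (chrAt G x W X) Y]
  simp only [_root_.neg_apply, ContinuousLinearMap.comp_neg, ContinuousLinearMap.neg_comp]
  abel

/-- `∂_W (R(·)(X,Y) Z)(x) = (∂_W R(X,Y)) Z`. [folklore] -/
theorem IsMetricOn.fderiv_riemAt_apply (hG : IsMetricOn G V) (hx : x ∈ V) (X Y Z W : E) :
    fderiv ℝ (fun y ↦ riemAt G y X Y Z) x W = fderiv ℝ (fun y ↦ riemAt G y X Y) x W Z :=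
  fderiv_clm_apply_const (hG.differentiableAt_riemAt hx X Y) Z W

/-- **The derivative of the curvature endomorphism**:
`∂_W R(X,Y) = D²Γ(W,X)(Y) − D²Γ(W,Y)(X) + DΓ(W,X) ∘ Γ_Y + Γ_X ∘ DΓ(W,Y) − DΓ(W,Y) ∘ Γ_X − Γ_Y ∘ DΓ(W,X)`
(product rule in `End E`). [folklore] -/
theorem IsMetricOn.fderiv_riemAt (hG : IsMetricOn G V) (hx : x ∈ V) (X Y W : E) :
    fderiv ℝ (fun y ↦ riemAt G y X Y) x W =
      fderiv ℝ (fderiv ℝ (chrAt G)) x W X Y - fderiv ℝ (fderiv ℝ (chrAt G)) x W Y X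
        + (fderiv ℝ (chrAt G) x W X).comp (chrAt G x Y) + (chrAt G x X).comp (fderiv ℝ (chrAt G) x W Y)
        - (fderiv ℝ (chrAt G) x W Y).comp (chrAt G x X)
        - (chrAt G x Y).comp (fderiv ℝ (chrAt G) x W X) := by
  have hΓ : DifferentiableAt ℝ (chrAt G) x := hG.differentiableAt_chrAt hx
  have hDΓ : DifferentiableAt ℝ (fderiv ℝ (chrAt G)) x :=
    ((hG.contDiffAt_chrAt hx).fderiv_right (m := ∞) (by simp)).differentiableAt (by simp)
  -- the four summands of `riemAt` as functions of the point, with their derivatives along `W`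
  have h1 : ∀ A B : E, HasFDerivAt (fun y ↦ fderiv ℝ (chrAt G) y A B)
      (((fderiv ℝ (fderiv ℝ (chrAt G)) x).flip A).flip B) x := fun A B ↦
    hasFDerivAt_clm_apply_const (hasFDerivAt_clm_apply_const hDΓ.hasFDerivAt A) B
  have h2 : ∀ A : E, HasFDerivAt (fun y ↦ chrAt G y A) ((fderiv ℝ (chrAt G) x).flip A) x := fun A ↦
    hasFDerivAt_clm_apply_const hΓ.hasFDerivAt A
  have h3 : ∀ A B : E, HasFDerivAt (fun y ↦ (chrAt G y A).comp (chrAt G y B))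
      ((ContinuousLinearMap.compL ℝ E E E (chrAt G x A)).comp ((fderiv ℝ (chrAt G) x).flip B) +
        ((ContinuousLinearMap.compL ℝ E E E).flip (chrAt G x B)).comp
          ((fderiv ℝ (chrAt G) x).flip A)) x := fun A B ↦ (h2 A).clm_comp (h2 B)
  have hsum : HasFDerivAt (fun y ↦ riemAt G y X Y)
      ((((fderiv ℝ (fderiv ℝ (chrAt G)) x).flip X).flip Y) - (((fderiv ℝ (fderiv ℝ (chrAt G)) x).flip Y).flip X)
        + ((ContinuousLinearMap.compL ℝ E E E (chrAt G x X)).comp ((fderiv ℝ (chrAt G) x).flip Y) +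
            ((ContinuousLinearMap.compL ℝ E E E).flip (chrAt G x Y)).comp ((fderiv ℝ (chrAt G) x).flip X))
        - ((ContinuousLinearMap.compL ℝ E E E (chrAt G x Y)).comp ((fderiv ℝ (chrAt G) x).flip X) +
            ((ContinuousLinearMap.compL ℝ E E E).flip (chrAt G x X)).comp ((fderiv ℝ (chrAt G) x).flip Y)))
      x := by
    have := (((h1 X Y).sub (h1 Y X)).add (h3 X Y)).sub (h3 Y X)
    exact this
  rw [hsum.fderiv]
  simp only [_root_.sub_apply, _root_.add_apply,
    ContinuousLinearMap.flip_apply, ContinuousLinearMap.comp_apply, ContinuousLinearMap.compL_apply]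
  abel

/-- Symmetry of the second derivative of the Christoffel map: `D²Γ(W,X) = D²Γ(X,W)`. [folklore] -/
theorem IsMetricOn.fderiv_fderiv_chrAt_comm (hG : IsMetricOn G V) (hx : x ∈ V) (W X : E) :
    fderiv ℝ (fderiv ℝ (chrAt G)) x W X = fderiv ℝ (fderiv ℝ (chrAt G)) x X W :=
  (hG.contDiffAt_chrAt hx).isSymmSndFDerivAt two_le_infty W X

/-- **Second Bianchi identity** for the curvature endomorphism of metric components:
`(∇_W R)(X,Y) + (∇_X R)(Y,W) + (∇_Y R)(W,X) = 0` (O'Neill 1983, Ch. 3, Prop. 3.37). Direct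
computation on constant fields: the second derivatives of `Γ` cancel by symmetry of `D²Γ`, the
terms `R(Γ(W,X),Y)` cancel in pairs by torsion-freeness `Γ(W,X) = Γ(X,W)` and skew-symmetry of
`R`, and the remaining products cancel by the Jacobi identity in `End E`.
[cite: ONeill1983, Ch. 3, Prop. 3.37] -/
theorem IsMetricOn.covRiemAt_cyclic (hG : IsMetricOn G V) (hx : x ∈ V) (W X Y : E) :
    covRiemAt G x W X Y + covRiemAt G x X Y W + covRiemAt G x Y W X = 0 := by
  simp only [covRiemAt, hG.fderiv_riemAt hx]
  have hc := hG.chrAt_comm hx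
  have h2 := hG.fderiv_fderiv_chrAt_comm hx
  -- torsion-freeness on the arguments of `R`, and skew-symmetry
  rw [hc X W, riemAt_swap G x (chrAt G x W X) Y, hc Y X, riemAt_swap G x (chrAt G x X Y) W,
    hc W Y, riemAt_swap G x (chrAt G x Y W) X]
  -- symmetry of second derivatives
  rw [h2 X Y, h2 Y W, h2 X W]
  simp only [riemAt, ContinuousLinearMap.comp_add, ContinuousLinearMap.comp_sub,
    ContinuousLinearMap.add_comp, ContinuousLinearMap.sub_comp, ContinuousLinearMap.comp_assoc]
  abel

/-! #### Lowering the index and the symmetries of `∇R` -/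

/-- **Lowering commutes with the covariant derivative**:
`G((∇_W R)(X,Y)Z, U) = ∂_W G(R(X,Y)Z, U) − G(R(Γ(W,X),Y)Z,U) − G(R(X,Γ(W,Y))Z,U)
  − G(R(X,Y)Γ(W,Z),U) − G(R(X,Y)Z,Γ(W,U))` (metric compatibility). [cite: ONeill1983, Ch. 3, p. 86] -/
theorem IsMetricOn.apply_covRiemAt (hG : IsMetricOn G V) (hx : x ∈ V) (W X Y Z U : E) :
    G x (covRiemAt G x W X Y Z) U =
      fderiv ℝ (fun y ↦ G y (riemAt G y X Y Z) U) x W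
        - G x (riemAt G x (chrAt G x W X) Y Z) U - G x (riemAt G x X (chrAt G x W Y) Z) U
        - G x (riemAt G x X Y (chrAt G x W Z)) U - G x (riemAt G x X Y Z) (chrAt G x W U) := by
  -- product rule for `y ↦ G y (R_y(X,Y)Z) U`
  set c : E → E := fun y ↦ riemAt G y X Y Z with hc
  have hcd : HasFDerivAt c ((fderiv ℝ (fun y ↦ riemAt G y X Y) x).flip Z) x :=
    hasFDerivAt_clm_apply_const (hG.differentiableAt_riemAt hx X Y).hasFDerivAt Z
  have hprod := hasFDerivAt_clm_apply_const
    ((hG.differentiableAt hx).hasFDerivAt.clm_apply hcd) U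
  have hval : fderiv ℝ (fun y ↦ G y (c y) U) x W =
      G x (fderiv ℝ (fun y ↦ riemAt G y X Y) x W Z) U + fderiv ℝ G x W (riemAt G x X Y Z) U := by
    rw [hprod.fderiv]; rfl
  simp only [hc] at hval
  rw [hval, covRiemAt_apply, hG.fderiv_eq_chrAt hx W (riemAt G x X Y Z) U]
  simp only [map_sub, map_add, _root_.sub_apply, _root_.add_apply]
  ring

/-- `G((∇_W R)(X,Y)Z, U)` is skew in `Z, U`. [cite: ONeill1983, Ch. 3, Prop. 3.36 (2)] -/
theorem IsMetricOn.apply_covRiemAt_swap (hG : IsMetricOn G V) (hx : x ∈ V) (W X Y Z U : E) :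
    G x (covRiemAt G x W X Y U) Z = -G x (covRiemAt G x W X Y Z) U := by
  rw [hG.apply_covRiemAt hx, hG.apply_covRiemAt hx]
  have hs := fun Z U ↦ hG.apply_riemAt_swap hx X Y Z U
  have heq : (fun y ↦ G y (riemAt G y X Y U) Z) =ᶠ[𝓝 x] fun y ↦ -G y (riemAt G y X Y Z) U :=
    (hG.eventually_mem hx).mono fun y hy ↦ hG.apply_riemAt_swap hy X Y Z U
  rw [heq.fderiv_eq, fderiv_fun_neg, _root_.neg_apply,
    hG.apply_riemAt_swap hx (chrAt G x W X) Y Z U, hG.apply_riemAt_swap hx X (chrAt G x W Y) Z U,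
    hs (chrAt G x W U) Z, hs U (chrAt G x W Z)]
  ring

omit [CompleteSpace E] in
/-- `(∇_W R)(Y,X) = −(∇_W R)(X,Y)`, paired. [cite: ONeill1983, Ch. 3, Prop. 3.36 (1)] -/
theorem apply_covRiemAt_swap₁₂ (W X Y Z U : E) :
    G x (covRiemAt G x W Y X Z) U = -G x (covRiemAt G x W X Y Z) U := by
  rw [covRiemAt_swap, _root_.neg_apply, map_neg, _root_.neg_apply]

/-- **Covariant derivative of the first Bianchi identity**:
`(∇_W R)(X,Y)Z + (∇_W R)(Y,Z)X + (∇_W R)(Z,X)Y = 0` (differentiate `R(X,Y)Z + R(Y,Z)X + R(Z,X)Y = 0`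
and regroup the correction terms into instances of the same identity).
[cite: ONeill1983, Ch. 3, Prop. 3.36 (3)] -/
theorem IsMetricOn.covRiemAt_cyclic₂ (hG : IsMetricOn G V) (hx : x ∈ V) (W X Y Z : E) :
    covRiemAt G x W X Y Z + covRiemAt G x W Y Z X + covRiemAt G x W Z X Y = 0 := by
  -- the derivative of the (vanishing) cyclic sum
  have hdf : ∀ A B C : E, HasFDerivAt (fun y ↦ riemAt G y A B C)
      ((fderiv ℝ (fun y ↦ riemAt G y A B) x).flip C) x := fun A B C ↦
    hasFDerivAt_clm_apply_const (hG.differentiableAt_riemAt hx A B).hasFDerivAt C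
  have hsumd := ((hdf X Y Z).fun_add (hdf Y Z X)).fun_add (hdf Z X Y)
  have hzero : (fun y ↦ riemAt G y X Y Z + riemAt G y Y Z X + riemAt G y Z X Y) =ᶠ[𝓝 x]
      fun _ ↦ (0 : E) :=
    (hG.eventually_mem hx).mono fun y hy ↦ hG.riemAt_cyclic hy X Y Z
  have hD : fderiv ℝ (fun y ↦ riemAt G y X Y) x W Z + fderiv ℝ (fun y ↦ riemAt G y Y Z) x W X
      + fderiv ℝ (fun y ↦ riemAt G y Z X) x W Y = 0 := by
    have h := hsumd.fderiv
    rw [hzero.fderiv_eq, fderiv_fun_const] at h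
    have hW := congrArg (fun T : E →L[ℝ] E ↦ T W) h
    simp only [Pi.zero_apply, _root_.zero_apply, _root_.add_apply,
      ContinuousLinearMap.flip_apply] at hW
    exact hW.symm
  have c0 : chrAt G x W (riemAt G x X Y Z) + chrAt G x W (riemAt G x Y Z X)
      + chrAt G x W (riemAt G x Z X Y) = 0 := by
    rw [← map_add, ← map_add, hG.riemAt_cyclic hx X Y Z, map_zero]
  have c1 := hG.riemAt_cyclic hx X Y (chrAt G x W Z)
  have c2 := hG.riemAt_cyclic hx (chrAt G x W X) Y Z
  have c3 := hG.riemAt_cyclic hx X (chrAt G x W Y) Z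
  calc covRiemAt G x W X Y Z + covRiemAt G x W Y Z X + covRiemAt G x W Z X Y
      = (fderiv ℝ (fun y ↦ riemAt G y X Y) x W Z + fderiv ℝ (fun y ↦ riemAt G y Y Z) x W X
          + fderiv ℝ (fun y ↦ riemAt G y Z X) x W Y)
        + (chrAt G x W (riemAt G x X Y Z) + chrAt G x W (riemAt G x Y Z X)
          + chrAt G x W (riemAt G x Z X Y))
        - (riemAt G x X Y (chrAt G x W Z) + riemAt G x Y (chrAt G x W Z) X
          + riemAt G x (chrAt G x W Z) X Y)
        - (riemAt G x (chrAt G x W X) Y Z + riemAt G x Y Z (chrAt G x W X)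
          + riemAt G x Z (chrAt G x W X) Y)
        - (riemAt G x X (chrAt G x W Y) Z + riemAt G x (chrAt G x W Y) Z X
          + riemAt G x Z X (chrAt G x W Y)) := by
        simp only [covRiemAt_apply]
        abel
    _ = 0 := by rw [hD, c0, c1, c2, c3]; simp

/-- **Pair symmetry of `∇R`**: `G((∇_W R)(X,Y)Z, U) = G((∇_W R)(Z,U)X, Y)` (from skew-symmetry in
both pairs and the differentiated first Bianchi identity, as for `R` itself).
[cite: ONeill1983, Ch. 3, Prop. 3.36 (4)] -/
theorem IsMetricOn.apply_covRiemAt_pair_comm (hG : IsMetricOn G V) (hx : x ∈ V) (W X Y Z U : E) :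
    G x (covRiemAt G x W X Y Z) U = G x (covRiemAt G x W Z U X) Y :=
  pair_comm_of_skew_of_cyclic (fun X Y Z U ↦ G x (covRiemAt G x W X Y Z) U)
    (fun X Y Z U ↦ apply_covRiemAt_swap₁₂ W X Y Z U)
    (fun X Y Z U ↦ hG.apply_covRiemAt_swap hx W X Y Z U)
    (fun X Y Z U ↦ by
      rw [← _root_.add_apply, ← _root_.add_apply, ← map_add, ← map_add,
        hG.covRiemAt_cyclic₂ hx W X Y Z, map_zero, _root_.zero_apply]) X Y Z U

end CovRiem

/-! ### Contractions: `tr ∘ ∇R = ∇Ric` and the contracted Bianchi identity -/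

section Contracted

variable {ι : Type*} [Fintype ι] [FiniteDimensional ℝ E] [CompleteSpace E]
  {G : E → E →L[ℝ] E →L[ℝ] ℝ} {V : Set E} {x : E} (b : Basis ι ℝ E)

omit [FiniteDimensional ℝ E] [CompleteSpace E] in
/-- Reindexing a fourfold sum: exchange the outer pair of indices with the inner pair. [folklore] -/
theorem sum_comm_pairs (f : ι → ι → ι → ι → ℝ) :
    ∑ k, ∑ l, ∑ i, ∑ j, f k l i j = ∑ i, ∑ j, ∑ k, ∑ l, f k l i j := by
  calc ∑ k, ∑ l, ∑ i, ∑ j, f k l i j = ∑ k, ∑ i, ∑ l, ∑ j, f k l i j :=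
        Finset.sum_congr rfl fun k _ ↦ Finset.sum_comm
    _ = ∑ i, ∑ k, ∑ l, ∑ j, f k l i j := Finset.sum_comm
    _ = ∑ i, ∑ k, ∑ j, ∑ l, f k l i j :=
        Finset.sum_congr rfl fun i _ ↦ Finset.sum_congr rfl fun k _ ↦ Finset.sum_comm
    _ = ∑ i, ∑ j, ∑ k, ∑ l, f k l i j := Finset.sum_congr rfl fun i _ ↦ Finset.sum_comm

omit [CompleteSpace E] in
/-- `tr (Γ_W ∘ (X ↦ R(X,Y)Z)) = tr ((X ↦ R(X,Y)Z) ∘ Γ_W)` in the basis. [folklore] -/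
theorem sum_coord_chrAt_riemAt_comm (x W Y Z : E) :
    ∑ i, b.coord i (chrAt G x W (riemAt G x (b i) Y Z)) =
      ∑ i, b.coord i (riemAt G x (chrAt G x W (b i)) Y Z) := by
  have h := LinearMap.trace_comp_comm' (ricciEndo G x Y Z) ((chrAt G x W : E →L[ℝ] E) : E →ₗ[ℝ] E)
  rw [trace_eq_sum_coord b, trace_eq_sum_coord b] at h
  simpa using h

/-- **Contraction commutes with the covariant derivative**: `tr (X ↦ (∇_W R)(X,Y)Z) = (∇_W Ric)(Y,Z)`,
i.e. `Σᵢ bⁱ((∇_W R)(bᵢ,Y)Z) = ∂_W Ric(Y,Z) − Ric(Γ(W,Y),Z) − Ric(Y,Γ(W,Z))`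
(O'Neill 1983, Ch. 3, p. 86; Ch. 2, contraction commutes with `D`). [cite: ONeill1983, Ch. 3, p. 86] -/
theorem IsMetricOn.sum_coord_covRiemAt (hG : IsMetricOn G V) (hx : x ∈ V) (W Y Z : E) :
    ∑ i, b.coord i (covRiemAt G x W (b i) Y Z) = cov₂At G (ricAt G) x W Y Z := by
  -- derivative of `Ric(Y,Z) = Σ bⁱ(R(bᵢ,Y)Z)`
  have hdiff : ∀ i, DifferentiableAt ℝ (fun y ↦ riemAt G y (b i) Y Z) x := fun i ↦
    differentiableAt_clm_apply_const (hG.differentiableAt_riemAt hx (b i) Y) Z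
  have hD : fderiv ℝ (ricAt G) x W Y Z =
      ∑ i, b.coord i (fderiv ℝ (fun y ↦ riemAt G y (b i) Y) x W Z) := by
    have hR : DifferentiableAt ℝ (ricAt G) x := hG.differentiableAt_ricAt hx
    rw [← fderiv_clm_apply_const hR Y W,
      ← fderiv_clm_apply_const (differentiableAt_clm_apply_const hR Y) Z W,
      show (fun y ↦ ricAt G y Y Z) = fun y ↦ ∑ i, coordCLM b i (riemAt G y (b i) Y Z) from
        funext fun y ↦ ricAt_eq_sum_coord b Y Z]
    have hs : HasFDerivAt (fun y ↦ ∑ i, coordCLM b i (riemAt G y (b i) Y Z))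
        (∑ i, (coordCLM b i).comp (fderiv ℝ (fun y ↦ riemAt G y (b i) Y Z) x)) x :=
      HasFDerivAt.fun_sum (u := Finset.univ)
        fun i (_ : i ∈ Finset.univ) ↦ (coordCLM b i).hasFDerivAt.comp x (hdiff i).hasFDerivAt
    rw [hs.fderiv, FunLike.coe_sum, Finset.sum_apply]
    refine Finset.sum_congr rfl fun i _ ↦ ?_
    rw [ContinuousLinearMap.comp_apply, coordCLM_apply, hG.fderiv_riemAt_apply hx]
  simp only [covRiemAt_apply, map_sub, map_add, Finset.sum_sub_distrib, Finset.sum_add_distrib,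
    cov₂At_apply, hD, sum_coord_chrAt_riemAt_comm b, ← ricAt_eq_sum_coord b]
  ring

/-- **Contracted Bianchi identity `dS = 2 div Ric`** (O'Neill 1983, Ch. 3, Cor. 3.54; Topping 2006,
(2.1.9): `δ Ric + ½ dR = 0`). For metric components `G` smooth, symmetric and nondegenerate near
`x`, in any basis `b` with inverse metric coefficients `g^{kl}`:
`∂_Y S(x) = 2 Σ_{kl} g^{kl} (∇_{b_k} Ric)(Y, b_l)`, i.e. `S_{;Y} = 2 g^{kl} Ric_{Yl;k}`.
Proof: trace the second Bianchi identity over its endomorphism slot (`sum_coord_covRiemAt`) and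
then through the metric, using the symmetries of `G((∇R)(X,Y)Z,U)`.
[cite: ONeill1983, Ch. 3, Cor. 3.54] -/
theorem IsMetricOn.fderiv_scalAt (hG : IsMetricOn G V) (hx : x ∈ V) (Y : E) :
    fderiv ℝ (scalAt G) x Y = 2 * ∑ k, ∑ l, ginv G b x k l * cov₂At G (ricAt G) x (b k) Y (b l) := by
  have hi := hG.isInvertible x hx
  -- (E2) `dS(Y) = Σ g^{kl} (∇_Y Ric)(b_k, b_l)`
  have hE2 : fderiv ℝ (scalAt G) x Y = ∑ k, ∑ l, ginv G b x k l * cov₂At G (ricAt G) x Y (b k) (b l) := by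
    rw [hG.fderiv_scalAt_eq_mtrAt hx, mtrAt_eq_sum b]
  -- (E1) the traced second Bianchi identity
  have hE1 : ∀ W Z, cov₂At G (ricAt G) x W Y Z + ∑ i, b.coord i (covRiemAt G x (b i) Y W Z)
      - cov₂At G (ricAt G) x Y W Z = 0 := by
    intro W Z
    have h' : ∀ i, b.coord i ((covRiemAt G x W (b i) Y + covRiemAt G x (b i) Y W
        + covRiemAt G x Y W (b i)) Z) = 0 := fun i ↦ by
      rw [hG.covRiemAt_cyclic hx W (b i) Y]; simp
    have hs := Finset.sum_eq_zero (s := Finset.univ) fun i (_ : i ∈ Finset.univ) ↦ h' i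
    simp only [_root_.add_apply, map_add, Finset.sum_add_distrib] at hs
    rw [hG.sum_coord_covRiemAt b hx] at hs
    have h3 : ∑ i, b.coord i (covRiemAt G x Y W (b i) Z) = -cov₂At G (ricAt G) x Y W Z := by
      rw [← hG.sum_coord_covRiemAt b hx Y W Z, ← Finset.sum_neg_distrib]
      refine Finset.sum_congr rfl fun i _ ↦ ?_
      rw [covRiemAt_swap, _root_.neg_apply, map_neg]
    rw [h3] at hs
    linarith
  -- (E4) the middle term, traced through the metric, is `div Ric (Y)` again
  set F : ι → ι → ι → ι → ℝ := fun a c d e ↦ G x (covRiemAt G x (b a) (b c) (b d) (b e)) Y with hF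
  have hQ : ∀ k l, ∑ i, b.coord i (covRiemAt G x (b i) Y (b k) (b l)) =
      ∑ i, ∑ j, ginv G b x i j * F i j l k := by
    intro k l
    refine Finset.sum_congr rfl fun i _ ↦ ?_
    rw [coord_eq_sum_ginv b hi]
    refine Finset.sum_congr rfl fun j _ ↦ ?_
    rw [hF, hG.apply_covRiemAt_pair_comm hx (b i) Y (b k) (b l) (b j),
      hG.apply_covRiemAt_swap hx (b i) (b l) (b j) (b k) Y, apply_covRiemAt_swap₁₂]
    ring
  have hdiv : ∀ k l, cov₂At G (ricAt G) x (b k) Y (b l) = ∑ i, ∑ j, ginv G b x i j * F k l j i := by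
    intro k l
    rw [← hG.sum_coord_covRiemAt b hx]
    refine Finset.sum_congr rfl fun i _ ↦ ?_
    rw [coord_eq_sum_ginv b hi]
    refine Finset.sum_congr rfl fun j _ ↦ ?_
    rw [hF, hG.apply_covRiemAt_pair_comm hx (b k) (b i) Y (b l) (b j)]
  have hmid : ∑ k, ∑ l, ginv G b x k l * ∑ i, b.coord i (covRiemAt G x (b i) Y (b k) (b l)) =
      ∑ k, ∑ l, ginv G b x k l * cov₂At G (ricAt G) x (b k) Y (b l) := by
    simp only [hQ, hdiv, Finset.mul_sum]
    rw [sum_comm_pairs]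
    refine Finset.sum_congr rfl fun i _ ↦ Finset.sum_congr rfl fun j _ ↦
      Finset.sum_congr rfl fun k _ ↦ Finset.sum_congr rfl fun l _ ↦ ?_
    ring
  -- (E3) trace (E1) through the metric
  have hE3 : ∑ k, ∑ l, ginv G b x k l * (cov₂At G (ricAt G) x (b k) Y (b l)
      + ∑ i, b.coord i (covRiemAt G x (b i) Y (b k) (b l)) - cov₂At G (ricAt G) x Y (b k) (b l)) = 0 :=
    Finset.sum_eq_zero fun k _ ↦ Finset.sum_eq_zero fun l _ ↦ by rw [hE1 (b k) (b l), mul_zero]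
  simp only [mul_add, mul_sub, Finset.sum_add_distrib, Finset.sum_sub_distrib, hmid] at hE3
  rw [hE2]
  linarith

/-- The contracted Bianchi identity with the symmetric slot order `(∇_{b_k} Ric)(b_l, Y)`:
`∂_Y S = 2 Σ g^{kl} Ric_{lY;k}` (`Ric` is symmetric). [cite: ONeill1983, Ch. 3, Cor. 3.54] -/
theorem IsMetricOn.fderiv_scalAt' (hG : IsMetricOn G V) (hx : x ∈ V) (Y : E) :
    fderiv ℝ (scalAt G) x Y = 2 * ∑ k, ∑ l, ginv G b x k l * cov₂At G (ricAt G) x (b k) (b l) Y := by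
  rw [hG.fderiv_scalAt b hx Y]
  congr 1
  refine Finset.sum_congr rfl fun k _ ↦ Finset.sum_congr rfl fun l _ ↦ ?_
  congr 1
  simp only [cov₂At_apply]
  have hsym : (fun y ↦ ricAt G y Y (b l)) =ᶠ[𝓝 x] fun y ↦ ricAt G y (b l) Y :=
    (hG.eventually_mem hx).mono fun y hy ↦ hG.ricAt_comm hy Y (b l)
  have hR := hG.differentiableAt_ricAt hx
  rw [← fderiv_clm_apply_const hR Y (b k),
    ← fderiv_clm_apply_const (differentiableAt_clm_apply_const hR Y) (b l) (b k), hsym.fderiv_eq,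
    fderiv_clm_apply_const (differentiableAt_clm_apply_const hR (b l)) Y (b k),
    fderiv_clm_apply_const hR (b l) (b k), hG.ricAt_comm hx (chrAt G x (b k) Y) (b l),
    hG.ricAt_comm hx Y (chrAt G x (b k) (b l))]
  ring

end Contracted

end MetricCoord

end Literature.Geometry.Lorentzian

end
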